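import Summits.NavierStokesRegularity.NavierStokesRegularity.Theorems.PerpetualPumpAveragedTypeIBlowupThresholdTools
import Summits.NavierStokesRegularity.NavierStokesRegularity.Theorems.PerpetualPumpAveragedTypeIBlowupKernel
import Summits.NavierStokesRegularity.NavierStokesRegularity.Theorems.PerpetualPumpAveragedTypeIBlowupWaveletSmallRadius
import Summits.NavierStokesRegularity.NavierStokesRegularity.Theorems.PerpetualPumpAveragedTypeIBlowupTodaLegal
import Summits.NavierStokesRegularity.NavierStokesRegularity.Theorems.PerpetualPumpAveragedTypeIBlowupWellposed
import Summits.NavierStokesRegularity.NavierStokesRegularity.Theorems.PerpetualPumpAveragedTypeIBlowupIvtNesting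
import Summits.NavierStokesRegularity.NavierStokesRegularity.Theorems.PerpetualPumpAveragedTypeIBlowupDieGlobalUnique
import Summits.NavierStokesRegularity.NavierStokesRegularity.Theorems.PerpetualPumpAveragedTypeIBlowupPeakAt
import Summits.NavierStokesRegularity.NavierStokesRegularity.Theorems.PerpetualPumpAveragedTypeIBlowupStepExists
import Summits.NavierStokesRegularity.NavierStokesRegularity.Theorems.PerpetualPumpAveragedTypeIBlowupInvAtZero
import Summits.NavierStokesRegularity.NavierStokesRegularity.Theorems.PerpetualPumpAveragedTypeIBlowupParameters
import Summits.NavierStokesRegularity.NavierStokesRegularity.Theorems.PerpetualPumpAveragedTypeIBlowupTypeIOfTube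
import Summits.NavierStokesRegularity.NavierStokesRegularity.Theorems.PerpetualPumpAveragedTypeIBlowupOneStep
import Literature.Analysis.FluidPDE.TaoAveragedCascadeHolds
import Literature.Analysis.FluidPDE.TaoCascadeModeDuhamel

/-!
# Crux `PerpetualPump.AveragedTypeIBlowup` (stmt-NavierStokesRegularity-1835), line `Sketch`:
# THE CHAIN-LEVEL THRESHOLD THEOREM `stub_threshold` (the composition; lead c1)

A PINNED ABRUPT STAIRCASE of the seeded graded Toda circuit on the exact Volterra chain. [cite: Tao2016AveragedNS, §§4–6]
-/

noncomputable section
set_option linter.dupNamespace false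
open MeasureTheory Set Filter Topology
open scoped ENNReal
open Literature.Analysis.FluidPDE Literature.Analysis.FluidPDE.Tao2016
open Literature.Analysis.FluidPDE.TaoCascade (quadTerm IsSymmetricCoeff IsCancellingCoeff)
namespace Summit.NavierStokesRegularity.NavierStokesRegularity.Theorems.PerpetualPumpAveragedTypeIBlowup

set_option maxHeartbeats 1000000 in
/-- **THE CHAIN-LEVEL THRESHOLD THEOREM** (registered stub `stub_threshold` of line `Sketch`): see the module
docstring. [cite: Tao2016AveragedNS, §§4–6] -/
theorem stub_threshold :
    ∀ ε₀ : ℝ, 0 < ε₀ → ε₀ ≤ 1 / 20 →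
      ∃ (m : ℕ) (𝒟 : CascadeWaveletData ε₀ m) (α : Fin m → Fin m → Fin m → ℤ × ℤ × ℤ → ℝ),
        IsSymmetricCoeff α ∧ IsCancellingCoeff α ∧
        ∃ (i₀ : Fin m) (n₀ : ℤ) (A S : ℝ), 0 < S ∧
          (∃ Y : Fin m → ℤ → ℝ → ℝ,
            (∀ i n, ContinuousOn (Y i n) (Ico 0 S)) ∧
            (∀ i n t, n < n₀ → Y i n t = 0) ∧
            (∀ S' : ℝ, S' < S → ∃ C : ℝ, ∀ (i : Fin m) (n : ℤ), ∀ t ∈ Icc 0 S',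
              (1 + ε₀) ^ ((20 : ℝ) * n) * |Y i n t| ≤ C) ∧
            (∀ (i : Fin m) (n : ℤ), ∀ t ∈ Ico 0 S,
              Y i n t = (if i = i₀ ∧ n = n₀ then A else 0) *
                  (pairing (heat t (cascadeWavelet ε₀ (𝒟.ψ i) n)) (cascadeWavelet ε₀ (𝒟.ψ i) n)).re +
                ∫ s in (0 : ℝ)..t,
                  (pairing (heat (t - s) (cascadeWavelet ε₀ (𝒟.ψ i) n)) (cascadeWavelet ε₀ (𝒟.ψ i) n)).re *
                    quadTerm ε₀ α Y i n s) ∧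
            (∃ M : ℝ, ∀ t ∈ Ico 0 S,
              (∑' p : Fin m × ℤ, ENNReal.ofReal ((1 + ε₀) ^ ((3 : ℝ) * p.2 / 2) *
                (Real.exp (-(4 * Real.pi ^ 2 * (1 + ε₀) ^ (2 * p.2) * t)) *
                    (if p.1 = i₀ ∧ p.2 = n₀ then |A| else 0) +
                  ∫ s in (0 : ℝ)..t, |quadTerm ε₀ α Y p.1 p.2 s| *
                    Real.exp (-(4 * Real.pi ^ 2 * (1 + ε₀) ^ (2 * p.2) * (t - s)))))) ≤
                ENNReal.ofReal (M / Real.sqrt (S - t)))) ∧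
          ¬ ∃ (S' : ℝ) (Y' : Fin m → ℤ → ℝ → ℝ), S < S' ∧
            (∀ i n, ContinuousOn (Y' i n) (Ico 0 S')) ∧
            (∀ i n t, n < n₀ → Y' i n t = 0) ∧
            (∀ S'' : ℝ, S'' < S' → ∃ C : ℝ, ∀ (i : Fin m) (n : ℤ), ∀ t ∈ Icc 0 S'',
              (1 + ε₀) ^ ((20 : ℝ) * n) * |Y' i n t| ≤ C) ∧
            (∀ (i : Fin m) (n : ℤ), ∀ t ∈ Ico 0 S',
              Y' i n t = (if i = i₀ ∧ n = n₀ then A else 0) *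
                  (pairing (heat t (cascadeWavelet ε₀ (𝒟.ψ i) n)) (cascadeWavelet ε₀ (𝒟.ψ i) n)).re +
                ∫ s in (0 : ℝ)..t,
                  (pairing (heat (t - s) (cascadeWavelet ε₀ (𝒟.ψ i) n)) (cascadeWavelet ε₀ (𝒟.ψ i) n)).re *
                    quadTerm ε₀ α Y' i n s) := by
  intro ε₀ hε₀ hε₀'
  obtain ⟨M, εb, lo, hi, blo, bhi, F, r, hεbM, hεb, hεb6, hFdef, hblodef, hblo4, hblolo, hlohi, hhibhi, hεbreg,
    hlogreg, hrange, hedgelo, hedgehi, hr, hr2, hθ1, hθ2, hη0, hηreg⟩ := stub_parameters ε₀ _ hε₀ hε₀' rfl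
  obtain ⟨𝒟, h𝒟⟩ := stub_waveletSmallRadius hε₀ r hr
  set Dc : ℝ := 4 * Real.pi ^ 2 * ((1 + ε₀ / 4) ^ 2 + r ^ 2) with hDc
  have hε₁ : ε₀ ≤ 1 := hε₀'.trans (by norm_num)
  have hL : (0:ℝ) < 1 + ε₀ := by linarith
  set αT : Fin 2 → Fin 2 → Fin 2 → ℤ × ℤ × ℤ → ℝ := (fun (i₁ i₂ i₃ : Fin 2) (μ : ℤ × ℤ × ℤ) => if i₁ = 1 ∧ i₂ = 1 ∧ i₃ = 0 ∧ μ = (0, 0, 0) then Dc else if i₁ = 1 ∧ i₂ = 0 ∧ i₃ = 1 ∧ μ = (0, 0, 0) then -Dc / 2 else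
          if i₁ = 0 ∧ i₂ = 1 ∧ i₃ = 1 ∧ μ = (0, 0, 0) then -Dc / 2 else
          if i₁ = 1 ∧ i₂ = 0 ∧ i₃ = 1 ∧ μ = (0, 1, 0) then Dc / 2 else
          if i₁ = 0 ∧ i₂ = 1 ∧ i₃ = 1 ∧ μ = (1, 0, 0) then Dc / 2 else
          if i₁ = 1 ∧ i₂ = 1 ∧ i₃ = 0 ∧ μ = (0, 0, 1) then -Dc else
          if i₁ = 0 ∧ i₂ = 0 ∧ i₃ = 1 ∧ μ = (0, 0, 0) then εb * Dc else
          if i₁ = 0 ∧ i₂ = 1 ∧ i₃ = 0 ∧ μ = (0, 0, 0) then -(εb * Dc) / 2 else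
          if i₁ = 1 ∧ i₂ = 0 ∧ i₃ = 0 ∧ μ = (0, 0, 0) then -(εb * Dc) / 2 else 0) with hαT
  obtain ⟨hsymm, hcanc, -⟩ := stub_todaLegal Dc (εb * Dc)
  refine ⟨2, 𝒟, αT, hsymm, hcanc, 0, 0, ?_⟩
  obtain ⟨kern, hkern⟩ : ∃ kern : Fin 2 → ℤ → ℝ → ℝ, ∀ (i : Fin 2) (n : ℤ) (τ : ℝ), kern i n τ = (pairing (heat τ (cascadeWavelet ε₀ (𝒟.ψ i) n)) (cascadeWavelet ε₀ (𝒟.ψ i) n)).re :=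
    ⟨_, fun _ _ _ => rfl⟩
  obtain ⟨bvo, hbvo⟩ : ∃ bvo : (Fin 2 → ℤ → ℝ → ℝ) → ℤ → ℝ → ℝ, ∀ (Y : Fin 2 → ℤ → ℝ → ℝ) (n : ℤ) (t : ℝ), bvo Y n t = -((1 + ε₀) ^ ((n : ℝ) / 2) * Y 0 n t) := ⟨_, fun _ _ _ => rfl⟩
  obtain ⟨wvo, hwvo⟩ : ∃ wvo : (Fin 2 → ℤ → ℝ → ℝ) → ℤ → ℝ → ℝ, ∀ (Y : Fin 2 → ℤ → ℝ → ℝ) (n : ℤ) (t : ℝ), wvo Y n t = (1 + ε₀) ^ ((n : ℝ) / 2) * Y 1 n t := ⟨_, fun _ _ _ => rfl⟩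
  obtain ⟨M0o, hM0o⟩ : ∃ M0o : ℝ → (Fin 2 → ℤ → ℝ → ℝ) → ℤ → ℝ → ℝ, ∀ (A : ℝ) (Y : Fin 2 → ℤ → ℝ → ℝ) (n : ℤ) (t : ℝ), M0o A Y n t = (1 + ε₀) ^ ((n : ℝ) / 2) * ((if n = 0 then |A| else 0) * (∫ ξ, Real.exp (-(heatRate ξ * t)) * modeWeight 𝒟 0 n ξ) +
          ∫ s in (0 : ℝ)..t, (∫ ξ, Real.exp (-(heatRate ξ * (t - s))) * modeWeight 𝒟 0 n ξ) *
            |quadTerm ε₀ αT Y 0 n s|) := ⟨_, fun _ _ _ _ => rfl⟩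
  obtain ⟨M1o, hM1o⟩ : ∃ M1o : ℝ → (Fin 2 → ℤ → ℝ → ℝ) → ℤ → ℝ → ℝ, ∀ (A : ℝ) (Y : Fin 2 → ℤ → ℝ → ℝ) (n : ℤ) (t : ℝ), M1o A Y n t = (1 + ε₀) ^ ((n : ℝ) / 2) * ∫ s in (0 : ℝ)..t, (∫ ξ, Real.exp (-(heatRate ξ * (t - s))) * modeWeight 𝒟 1 n ξ) *
          |quadTerm ε₀ αT Y 1 n s| := ⟨_, fun _ _ _ _ => rfl⟩
  set q : ℝ := Real.sqrt (1 + ε₀) with hq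
  obtain ⟨R, hR⟩ : ∃ R : ℤ → ℝ, ∀ k : ℤ, R k = Dc * (1 + ε₀) ^ (2 * k) := ⟨_, fun _ => rfl⟩
  obtain ⟨lad, hlad⟩ : ∃ lad : ℕ → ℝ, ∀ j : ℕ, lad j = εb * ((1 + ε₀) ^ (19 * (j - 2)))⁻¹ := ⟨_, fun _ => rfl⟩
  obtain ⟨Sol, hSol⟩ : ∃ Sol : ℝ → ℝ → (Fin 2 → ℤ → ℝ → ℝ) → Prop, ∀ (A S : ℝ) (Y : Fin 2 → ℤ → ℝ → ℝ), Sol A S Y ↔ (0 < S ∧ (∀ i n, ContinuousOn (Y i n) (Ico 0 S)) ∧ (∀ i n t, n < 0 → Y i n t = 0) ∧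
        (∀ S' : ℝ, S' < S → ∃ C : ℝ, ∀ (i : Fin 2) (n : ℤ), ∀ t ∈ Icc 0 S',
          (1 + ε₀) ^ ((20 : ℝ) * n) * |Y i n t| ≤ C) ∧
        (∀ (i : Fin 2) (n : ℤ), ∀ t ∈ Ico 0 S,
          Y i n t = (if i = 0 ∧ n = 0 then A else 0) * kern i n t +
            ∫ s in (0 : ℝ)..t, kern i n (t - s) * quadTerm ε₀ αT Y i n s)) := ⟨_, fun _ _ _ => Iff.rfl⟩
  obtain ⟨Invo, hInvo⟩ : ∃ Invo : ℝ → (Fin 2 → ℤ → ℝ → ℝ) → ℤ → ℝ → ℝ → Prop, ∀ (A : ℝ) (Y : Fin 2 → ℤ → ℝ → ℝ) (m : ℤ) (Bm t : ℝ), Invo A Y m Bm t ↔ (bvo Y m t = Bm ∧ (∀ s ∈ Icc 0 t, bvo Y m s ≤ Bm) ∧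
        (0 ≤ wvo Y m t ∧ wvo Y m t ≤ F * εb * Bm ∧ M1o A Y m t ≤ F * εb * Bm ∧ M0o A Y m t ≤ 2 * Bm) ∧
        (0 ≤ m - 1 → 0 ≤ wvo Y (m - 1) t ∧ q ^ 3 * Bm - 1 ≤ (wvo Y (m - 1) t) ^ 2 ∧
          (wvo Y (m - 1) t) ^ 2 ≤ q ^ 3 * Bm + 1 ∧ 9 / 20 ≤ bvo Y (m - 1) t ∧ bvo Y (m - 1) t ≤ 11 / 20 ∧
          M0o A Y (m - 1) t ≤ 5 * (bhi + 4) ^ 2 ∧ M1o A Y (m - 1) t ≤ 5 * (bhi + 4) ^ 2) ∧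
        (|bvo Y (m + 1) t| ≤ εb ∧ |wvo Y (m + 1) t| ≤ εb ∧ M0o A Y (m + 1) t ≤ εb ∧ M1o A Y (m + 1) t ≤ εb) ∧
        (∀ j : ℕ, 2 ≤ j → |bvo Y (m + j) t| ≤ lad j ∧ |wvo Y (m + j) t| ≤ lad j / 5 ∧
          M0o A Y (m + j) t ≤ lad j ∧ M1o A Y (m + j) t ≤ lad j) ∧
        (∀ j : ℕ, 1 ≤ j → ∀ s ∈ Icc 0 t, bvo Y (m + j) s ≤ 1 / 2) ∧
        (∀ k : ℤ, 0 ≤ k → k ≤ m - 2 → ∃ te ∈ Icc 0 t,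
          (-(2 / 5) ≤ bvo Y k te ∧ bvo Y k te ≤ 3 / 10 ∧ |wvo Y k te| ≤ 1 / 200 ∧
            M0o A Y k te ≤ 10 * (bhi + 4) ^ 2 ∧ M1o A Y k te ≤ 10 * (bhi + 4) ^ 2) ∧
          ∀ s ∈ Icc te t, -(9 / 20) ≤ bvo Y k s ∧ bvo Y k s ≤ 7 / 20 ∧ |wvo Y k s| ≤ 1 / 100 ∧
            M0o A Y k s ≤ 10 * (bhi + 4) ^ 2 + 1 ∧ M1o A Y k s ≤ 10 * (bhi + 4) ^ 2 + 1 ∧ |wvo Y (k - 1) s| ≤ 1 / 100 ∧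
            -(1 / 2) ≤ bvo Y (k + 1) s ∧ bvo Y (k + 1) s ≤ 9 / 10)) := ⟨_, fun _ _ _ _ _ => Iff.rfl⟩
  obtain ⟨Tubeo, hTubeo⟩ : ∃ Tubeo : ℝ → (Fin 2 → ℤ → ℝ → ℝ) → ℤ → ℝ → Prop, ∀ (A : ℝ) (Y : Fin 2 → ℤ → ℝ → ℝ) (m : ℤ) (t : ℝ), Tubeo A Y m t ↔ ((∀ k : ℤ, k ≤ m + 1 → |bvo Y k t| ≤ 2 * (bhi + 3) ∧ |wvo Y k t| ≤ 2 * (bhi + 3) ∧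
          M0o A Y k t ≤ 20 * (bhi + 4) ^ 2 ∧ M1o A Y k t ≤ 20 * (bhi + 4) ^ 2) ∧
        (∀ j : ℕ, 2 ≤ j → |bvo Y (m + j) t| ≤ lad j ∧ |wvo Y (m + j) t| ≤ lad j ∧
          M0o A Y (m + j) t ≤ lad j ∧ M1o A Y (m + j) t ≤ lad j)) := ⟨_, fun _ _ _ _ => Iff.rfl⟩
  obtain ⟨Pkg, hPkg⟩ : ∃ Pkg : ℝ → (Fin 2 → ℤ → ℝ → ℝ) → ℝ → ℤ → ℝ → ℝ → ℝ → ℝ → Prop, ∀ (A : ℝ) (Y : Fin 2 → ℤ → ℝ → ℝ) (S : ℝ) (n : ℤ) (t₀ B t₁ B' : ℝ), Pkg A Y S n t₀ B t₁ B' ↔ (t₀ < t₁ ∧ t₁ < S ∧ t₁ ≤ t₀ + 4 / R n ∧ Invo A Y (n + 1) B' t₁ ∧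
        q * (B + Real.log εb - 6 * Real.log (B + 2) - 58) ≤ B' ∧
        B' ≤ q * (B + Real.log (10 * (F + 2) * εb * B) + 25) ∧
        (∀ t ∈ Icc t₀ t₁, Tubeo A Y n t ∧ bvo Y n t ≤ B + 3) ∧
        (∃ tc ∈ Ioo t₀ t₁, (∀ s ∈ Ico t₀ tc, bvo Y (n + 1) s < 1) ∧ bvo Y (n + 1) tc = 1 ∧
          ∃ δ : ℝ, 0 < δ ∧ tc + δ ≤ t₁ ∧ ∀ s ∈ Ioc tc (tc + δ), 1 < bvo Y (n + 1) s)) := ⟨_, fun _ _ _ _ _ _ _ _ => Iff.rfl⟩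
  have hka : ∀ (i : Fin 2) (n : ℤ) (τ : ℝ), |kern i n τ| ≤ 1 := fun i n τ => by
    rw [hkern]; exact abs_re_pairing_heat_cascadeWavelet_le hε₀ 𝒟 i n τ
  have hkc : ∀ (i : Fin 2) (n : ℤ), Continuous (kern i n) := fun i n => by
    have : kern i n = fun τ => (pairing (heat τ (cascadeWavelet ε₀ (𝒟.ψ i) n)) (cascadeWavelet ε₀ (𝒟.ψ i) n)).re :=
      funext fun τ => hkern i n τ
    rw [this]; exact continuous_re_pairing_heat_cascadeWavelet 𝒟 i n
  have hk0 : ∀ (i : Fin 2) (n : ℤ), kern i n 0 = 1 := fun i n => by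
    rw [hkern]; exact (stub_kernel hε₀ hε₁ 𝒟 i n).1
  have huniq : ∀ (A S₁ S₂ : ℝ) (Y₁ Y₂ : Fin 2 → ℤ → ℝ → ℝ), Sol A S₁ Y₁ → Sol A S₂ Y₂ → ∀ (i : Fin 2) (n : ℤ), ∀ t ∈ Ico 0 (min S₁ S₂), Y₁ i n t = Y₂ i n t := by
    intro A S₁ S₂ Y₁ Y₂ h₁ h₂
    obtain ⟨-, hc₁, hl₁, hd₁, hch₁⟩ := (hSol A S₁ Y₁).1 h₁
    obtain ⟨-, hc₂, hl₂, hd₂, hch₂⟩ := (hSol A S₂ Y₂).1 h₂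
    exact chain_unique hε₀ αT kern hka hkc 0 0 A hc₁ hl₁ hd₁ hch₁ hc₂ hl₂ hd₂ hch₂
  obtain ⟨val, hval⟩ : ∃ val : ℝ → Fin 2 → ℤ → ℝ → ℝ, ∀ (A S : ℝ) (Y : Fin 2 → ℤ → ℝ → ℝ), Sol A S Y → ∀ (i : Fin 2) (n : ℤ), ∀ t ∈ Ico 0 S, val A i n t = Y i n t := by
    classical
    refine ⟨fun A i n t => if h : ∃ S : ℝ, ∃ Y : Fin 2 → ℤ → ℝ → ℝ, Sol A S Y ∧ t < S then
      h.choose_spec.choose i n t else 0, fun A S Y hY i n t ht => ?_⟩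
    have hex : ∃ S : ℝ, ∃ Y : Fin 2 → ℤ → ℝ → ℝ, Sol A S Y ∧ t < S := ⟨S, Y, hY, ht.2⟩
    simp only [dif_pos hex]
    obtain ⟨hS', ht'⟩ := hex.choose_spec.choose_spec
    exact huniq A _ S _ Y hS' hY i n t ⟨ht.1, lt_min ht' ht.2⟩
  obtain ⟨β, hβ⟩ : ∃ β : ℕ → ℝ → ℝ, ∀ (k : ℕ) (P : ℝ), β k P = sSup ((fun t => bvo (val (-P)) k t) '' Icc 0 (sInf {t : ℝ | 0 ≤ t ∧ 1 ≤ bvo (val (-P)) ((k : ℤ) + 1) t})) :=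
    ⟨_, fun _ _ => rfl⟩
  have hcert : ∀ (k : ℕ) (P S t₀ B t₁ B' : ℝ) (Y : Fin 2 → ℤ → ℝ → ℝ), Sol (-P) S Y → (bvo Y k t₀ = B ∧ (∀ s ∈ Icc 0 t₀, bvo Y k s ≤ B) ∧ (∀ s ∈ Icc 0 t₀, bvo Y ((k : ℤ) + 1) s ≤ 1 / 2)) → 0 ≤ t₀ →
      Pkg (-P) Y S k t₀ B t₁ B' → β k P ∈ Icc B (B + 3) ∧ ContinuousAt (β k) P := by
    intro k P S t₀ B t₁ B' Y hY hI ht₀ hP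
    obtain ⟨ht01, ht1S, -, -, -, -, htube, tc, htc, hbelow, hat, δ, hδ, hδt1, habove⟩ :=
      (hPkg (-P) Y S k t₀ B t₁ B').1 hP
    obtain ⟨hbt₀, hfront, hhist⟩ := hI
    obtain ⟨hS0, hcY, -, -, -⟩ := (hSol (-P) S Y).1 hY
    have htcS : tc + δ < S := lt_of_le_of_lt hδt1 ht1S
    have hlt : ∀ t ∈ Ico 0 tc, bvo Y ((k : ℤ) + 1) t < 1 := fun t ht => by
      rcases lt_or_ge t t₀ with h | h
      · have := hhist t ⟨ht.1, h.le⟩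
        linarith
      · exact hbelow t ⟨h, ht.2⟩
    obtain ⟨hcontA, hvalue⟩ := stub_peakAt hε₀ hε₀' 𝒟 r Dc εb αT kern bvo wvo M0o M1o q R lad Sol hr hr2
      h𝒟 hDc hεb hαT hkern hbvo hwvo hM0o hM1o hq hR hlad hSol val hval (-P) S tc δ Y k hY (ht₀.trans_lt htc.1)
      hδ htcS hlt hat habove
    have hcb : ContinuousOn (fun t => bvo Y k t) (Icc 0 tc) := by
      have : (fun t => bvo Y k t) = fun t => -((1 + ε₀) ^ (((k : ℤ) : ℝ) / 2) * Y 0 k t) := funext fun t => hbvo Y k t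
      rw [this]
      exact (continuousOn_const.mul ((hcY 0 k).mono (Icc_subset_Ico_right (by linarith [htc.2])))).neg
    refine ⟨?_, ?_⟩
    · rw [hβ, hvalue]
      refine threshold_sSup_image_mem hcb ⟨ht₀, htc.1.le⟩ hbt₀ fun t ht => ?_
      rcases le_or_gt t t₀ with h | h
      · linarith [hfront t ⟨ht.1, h⟩]
      · linarith [(htube t ⟨h.le, ht.2.trans (by linarith)⟩).2]
    · have hcomp : β k = (fun A => sSup ((fun t => bvo (val A) k t) '' Icc 0 (sInf {t : ℝ | 0 ≤ t ∧ 1 ≤ bvo (val A) ((k : ℤ) + 1) t}))) ∘ fun P => -P := funext fun P => hβ k P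
      rw [hcomp]
      exact ContinuousAt.comp hcontA continuous_neg.continuousAt
  set θf : ℝ := (1 + ε₀ / 4 - r) ^ 2 / ((1 + ε₀ / 4) ^ 2 + r ^ 2) with hθf
  set ηf : ℝ := 2 * (1 + ε₀ / 4) * r / ((1 + ε₀ / 4) ^ 2 + r ^ 2) with hηf
  have hblo' : 10 ^ 4 + 40 - 5 * Real.log εb ≤ blo := hblodef.symm.le
  have hF' : 10 ^ 9 * (bhi + 4) ^ 4 ≤ F := hFdef.symm.le
  have hlo3 : 0 < lo - 3 := by linarith
  have hF0 : (0:ℝ) ≤ F := by rw [hFdef]; positivity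
  obtain ⟨Cert, hCertIff⟩ : ∃ Cert : ℕ → ℝ → Prop, ∀ (k : ℕ) (P : ℝ), Cert k P ↔ ∃ (S : ℝ) (Y : Fin 2 → ℤ → ℝ → ℝ) (t₀ B t₁ B' : ℝ), Sol (-P) S Y ∧ 0 ≤ t₀ ∧ blo ≤ B ∧ B ≤ bhi ∧
        (bvo Y k t₀ = B ∧ (∀ s ∈ Icc 0 t₀, bvo Y k s ≤ B) ∧ (∀ s ∈ Icc 0 t₀, bvo Y ((k : ℤ) + 1) s ≤ 1 / 2)) ∧
        Pkg (-P) Y S k t₀ B t₁ B' := ⟨_, fun _ _ => Iff.rfl⟩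
  have hstepE : ∀ (P S₀ : ℝ) (Y₀ : Fin 2 → ℤ → ℝ → ℝ) (n : ℕ) (B t₀ : ℝ), Sol (-P) S₀ Y₀ → 0 ≤ t₀ → t₀ < S₀ → blo ≤ B → B ≤ bhi → Invo (-P) Y₀ n B t₀ → ∃ (S : ℝ) (Y : Fin 2 → ℤ → ℝ → ℝ) (t₁ B' : ℝ), Sol (-P) S Y ∧ Pkg (-P) Y S n t₀ B t₁ B' ∧
        (bvo Y n t₀ = B ∧ (∀ s ∈ Icc 0 t₀, bvo Y n s ≤ B) ∧ (∀ s ∈ Icc 0 t₀, bvo Y ((n : ℤ) + 1) s ≤ 1 / 2)) := by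
    intro P S₀ Y₀ n B t₀ hY₀ ht₀ ht₀S hBlo hBhi hI
    obtain ⟨S, Y, hY, ht₀S', hagree, t₁, ht₁, ht₁4, B', hI', hg₁, hg₂, htube, hcross⟩ :=
      stub_stepExists hε₀ hε₀' 𝒟 r Dc εb αT kern bvo wvo M0o M1o q R lad Sol hr hr2
        h𝒟 hDc hεb hαT hkern hbvo hwvo hM0o hM1o hq hR hlad hSol F bhi Invo hInvo Tubeo hTubeo θf ηf blo hθf hηf
        hεb6 hθ1 hθ2 hblo' hF' hηreg hεbreg hlogreg stub_oneStep (-P) S₀ Y₀ n B t₀ hY₀ (by exact_mod_cast n.zero_le)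
        ht₀ ht₀S hBlo hBhi hI
    refine ⟨S, Y, t₁, B', hY, (hPkg (-P) Y S n t₀ B t₁ B').2 ⟨ht₁.1, ht₁.2, ht₁4, hI', hg₁, hg₂, htube, hcross⟩, ?_⟩
    obtain ⟨hbt₀, hfront, -, -, -, -, hhist, -⟩ := (hInvo (-P) Y₀ n B t₀).1 hI
    have hag : ∀ (m : ℤ), ∀ s ∈ Icc 0 t₀, bvo Y m s = bvo Y₀ m s := fun m s hs => by
      rw [hbvo, hbvo, hagree 0 m s ⟨hs.1, lt_min (hs.2.trans_lt ht₀S') (hs.2.trans_lt ht₀S)⟩]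
    refine ⟨?_, fun s hs => ?_, fun s hs => ?_⟩
    · rw [hag n t₀ ⟨ht₀, le_rfl⟩]; exact hbt₀
    · rw [hag n s hs]; exact hfront s hs
    · rw [hag _ s hs]; have := hhist 1 le_rfl s hs; push_cast at this; exact this
  have hbase : ∀ P : ℝ, blo ≤ P → P ≤ bhi → Cert 0 P := by
    intro P hP1 hP2
    have hP0 : 0 < P := by linarith
    obtain ⟨S₀, Y₀, hS₀, hc, hl, hd, hch⟩ := (stub_wellposed hε₀ hε₁ 𝒟 αT 0 0).1 (-P)
    have hY₀ : Sol (-P) S₀ Y₀ :=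
      (hSol _ _ _).2 ⟨hS₀, hc, hl, hd, fun i n t ht => by simp only [hkern]; exact hch i n t ht⟩
    have hInv0 : Invo (-P) Y₀ 0 P 0 := stub_invAtZero hε₀ hε₀' 𝒟 r Dc εb αT kern bvo wvo M0o M1o q R lad Sol hr hr2
      h𝒟 hDc hεb hαT hkern hbvo hwvo hM0o hM1o hq hR hlad hSol F bhi Invo hInvo (-P) S₀ P Y₀ hY₀ rfl hP0 hF0
    obtain ⟨S, Y, t₁, B', hY, hP', hfacts⟩ := hstepE P S₀ Y₀ 0 P 0 hY₀ le_rfl hS₀ hP1 hP2 (by exact_mod_cast hInv0)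
    exact (hCertIff 0 P).2 ⟨S, Y, 0, P, t₁, B', hY, le_rfl, hP1, hP2, hfacts, hP'⟩
  have hstepC : ∀ (k : ℕ) (P : ℝ), Cert k P → β k P ∈ Icc lo hi → Cert (k + 1) P := by
    intro k P hC hβk
    obtain ⟨S, Y, t₀, B, t₁, B', hY, ht₀, hB1, hB2, hfacts, hP⟩ := (hCertIff k P).1 hC
    obtain ⟨hβB, -⟩ := hcert k P S t₀ B t₁ B' Y hY hfacts ht₀ hP
    have hBlo : lo - 3 ≤ B := by linarith [hβB.2, hβk.1]
    have hBhi : B ≤ hi := le_trans hβB.1 hβk.2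
    obtain ⟨hr1, hr2'⟩ := hrange B hBlo hBhi
    obtain ⟨ht01, ht1S, -, hI', hg₁, hg₂, -, -⟩ := (hPkg (-P) Y S k t₀ B t₁ B').1 hP
    have hB'1 : blo ≤ B' := hr1.trans hg₁
    have hB'2 : B' ≤ bhi := hg₂.trans hr2'
    obtain ⟨S', Y', t₂, B'', hY', hP', hfacts'⟩ :=
      hstepE P S Y (k + 1) B' t₁ hY (by linarith) ht1S hB'1 hB'2 (by push_cast; exact hI')
    exact (hCertIff (k + 1) P).2 ⟨S', Y', t₁, B', t₂, B'', hY', by linarith, hB'1, hB'2, hfacts', hP'⟩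
  have hCertAll : ∀ (k : ℕ) (P : ℝ), lo - 3 ≤ P → P ≤ hi → (∀ j : ℕ, j < k → β j P ∈ Icc lo hi) → Cert k P := by
    intro k
    induction k with
    | zero => intro P h1 h2 _; exact hbase P (by linarith) (h2.trans hhibhi)
    | succ k ih =>
      intro P h1 h2 hj
      exact hstepC k P (ih P h1 h2 fun j hj' => hj j (Nat.lt_succ_of_lt hj')) (hj k k.lt_succ_self)
  have hβ0 : ∀ P : ℝ, lo - 3 ≤ P → P ≤ hi → β 0 P ∈ Icc P (P + 3) ∧ ContinuousAt (β 0) P := by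
    intro P hP1 hP2
    have hP0 : 0 < P := by linarith
    have hPb : blo ≤ P := by linarith
    have hPh : P ≤ bhi := hP2.trans hhibhi
    obtain ⟨S₀, Y₀, hS₀, hc, hl, hd, hch⟩ := (stub_wellposed hε₀ hε₁ 𝒟 αT 0 0).1 (-P)
    have hY₀ : Sol (-P) S₀ Y₀ :=
      (hSol _ _ _).2 ⟨hS₀, hc, hl, hd, fun i n t ht => by simp only [hkern]; exact hch i n t ht⟩
    have hInv0 : Invo (-P) Y₀ 0 P 0 := stub_invAtZero hε₀ hε₀' 𝒟 r Dc εb αT kern bvo wvo M0o M1o q R lad Sol hr hr2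
      h𝒟 hDc hεb hαT hkern hbvo hwvo hM0o hM1o hq hR hlad hSol F bhi Invo hInvo (-P) S₀ P Y₀ hY₀ rfl hP0 hF0
    obtain ⟨S, Y, t₁, B', hY, hP', hfacts⟩ := hstepE P S₀ Y₀ 0 P 0 hY₀ le_rfl hS₀ hPb hPh (by exact_mod_cast hInv0)
    exact hcert 0 P S 0 P t₁ B' Y hY hfacts le_rfl hP'
  have hnext : ∀ (k : ℕ) (P : ℝ), Cert k P → β k P ∈ Icc lo hi → ∃ B B' : ℝ, β k P ∈ Icc B (B + 3) ∧ q * (B + Real.log εb - 6 * Real.log (B + 2) - 58) ≤ B' ∧ B' ≤ q * (B + Real.log (10 * (F + 2) * εb * B) + 25) ∧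
      β (k + 1) P ∈ Icc B' (B' + 3) ∧ ContinuousAt (β (k + 1)) P := by
    intro k P hC hβk
    obtain ⟨S, Y, t₀, B, t₁, B', hY, ht₀, hB1, hB2, hfacts, hP⟩ := (hCertIff k P).1 hC
    obtain ⟨hβB, -⟩ := hcert k P S t₀ B t₁ B' Y hY hfacts ht₀ hP
    have hBlo : lo - 3 ≤ B := by linarith [hβB.2, hβk.1]
    have hBhi : B ≤ hi := le_trans hβB.1 hβk.2
    obtain ⟨hr1, hr2'⟩ := hrange B hBlo hBhi
    obtain ⟨ht01, ht1S, -, hI', hg₁, hg₂, -, -⟩ := (hPkg (-P) Y S k t₀ B t₁ B').1 hP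
    obtain ⟨S', Y', t₂, B'', hY', hP', hfacts'⟩ :=
      hstepE P S Y (k + 1) B' t₁ hY (by linarith) ht1S (hr1.trans hg₁) (hg₂.trans hr2') (by push_cast; exact hI')
    exact ⟨B, B', hβB, hg₁, hg₂, hcert (k + 1) P S' t₁ B' t₂ B'' Y' hY' hfacts' (by linarith) hP'⟩
  have hlohi' : lo < hi := by linarith
  have hβ0c : ContinuousOn (β 0) (Icc (lo - 3) hi) := fun P hP => (hβ0 P hP.1 hP.2).2.continuousWithinAt
  obtain ⟨v₀, hv₀, hβv₀, hv₀lt⟩ := ivtNesting_exists_first_eq (show lo - 3 ≤ hi by linarith) hβ0c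
    (show β 0 (lo - 3) ≤ hi by linarith [(hβ0 (lo - 3) le_rfl (by linarith)).1.2])
    (show hi ≤ β 0 hi from (hβ0 hi (by linarith) le_rfl).1.1)
  obtain ⟨u₀, hu₀, hβu₀, hu₀gt⟩ := ivtNesting_exists_last_eq hv₀.1 (hβ0c.mono (Icc_subset_Icc_right hv₀.2))
    (show β 0 (lo - 3) ≤ lo by linarith [(hβ0 (lo - 3) le_rfl (by linarith)).1.2]) (show lo ≤ β 0 v₀ by rw [hβv₀]; exact hlohi'.le)
  have huv : u₀ ≤ v₀ := hu₀.2
  have hIuv : Icc u₀ v₀ ⊆ Icc (lo - 3) hi := Icc_subset_Icc hu₀.1 hv₀.2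
  have hβ0in : ∀ A ∈ Icc u₀ v₀, β 0 A ∈ Icc lo hi := fun A hA => by
    refine ⟨?_, ?_⟩
    · rcases eq_or_lt_of_le hA.1 with h | h
      · rw [← h, hβu₀]
      · exact (hu₀gt A ⟨h, hA.2⟩).le
    · rcases eq_or_lt_of_le hA.2 with h | h
      · rw [h, hβv₀]
      · exact (hv₀lt A ⟨hu₀.1.trans hA.1, h⟩).le
  have hlevel : ∀ k : ℕ, ContinuousOn (β (k + 1)) {A ∈ Icc u₀ v₀ | ∀ j ≤ k, β j A ∈ Icc lo hi} ∧ (∀ A ∈ Icc u₀ v₀, (∀ j ≤ k, β j A ∈ Icc lo hi) → β k A = lo → β (k + 1) A < lo) ∧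
      (∀ A ∈ Icc u₀ v₀, (∀ j ≤ k, β j A ∈ Icc lo hi) → β k A = hi → hi < β (k + 1) A) := by
    intro k
    have hC : ∀ A ∈ Icc u₀ v₀, (∀ j ≤ k, β j A ∈ Icc lo hi) → Cert k A := fun A hA hj =>
      hCertAll k A (hIuv hA).1 (hIuv hA).2 fun j hj' => hj j hj'.le
    refine ⟨fun A hA => ?_, fun A hA hj hlo => ?_, fun A hA hj hhi => ?_⟩
    · obtain ⟨-, -, -, -, -, -, hcont⟩ := hnext k A (hC A hA.1 hA.2) (hA.2 k le_rfl)
      exact hcont.continuousWithinAt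
    · obtain ⟨B, B', hβB, hg₁, hg₂, hβB', -⟩ := hnext k A (hC A hA hj) (hj k le_rfl)
      have hB1 : lo - 3 ≤ B := by linarith [hβB.2]
      have hB2 : B ≤ lo := by linarith [hβB.1]
      have := hedgelo B hB1 hB2
      linarith [hβB'.2]
    · obtain ⟨B, B', hβB, hg₁, hg₂, hβB', -⟩ := hnext k A (hC A hA hj) (hj k le_rfl)
      have hB1 : hi - 3 ≤ B := by linarith [hβB.2]
      have hB2 : B ≤ hi := by linarith [hβB.1]
      have := hedgehi B hB1 hB2
      linarith [hβB'.1]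
  obtain ⟨Pstar, hPstar, hpin⟩ := stub_ivtNesting β lo hi u₀ v₀ hlohi' huv (hβ0c.mono hIuv) hβu₀ hβv₀ hβ0in hlevel
  set A : ℝ := -Pstar with hAdef
  have hPrange : lo - 3 ≤ Pstar ∧ Pstar ≤ hi := ⟨(hIuv hPstar).1, (hIuv hPstar).2⟩
  have hrec : ∀ (k : ℕ) (d : ℝ × (Fin 2 → ℤ → ℝ → ℝ) × ℝ × ℝ), (Sol A d.1 d.2.1 ∧ 0 ≤ d.2.2.1 ∧ d.2.2.1 < d.1 ∧ blo ≤ d.2.2.2 ∧ d.2.2.2 ≤ bhi ∧ Invo A d.2.1 k d.2.2.2 d.2.2.1) → ∃ d' : ℝ × (Fin 2 → ℤ → ℝ → ℝ) × ℝ × ℝ,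
        (Sol A d'.1 d'.2.1 ∧ 0 ≤ d'.2.2.1 ∧ d'.2.2.1 < d'.1 ∧ blo ≤ d'.2.2.2 ∧ d'.2.2.2 ≤ bhi ∧
          Invo A d'.2.1 (k + 1 : ℕ) d'.2.2.2 d'.2.2.1) ∧
        Pkg A d'.2.1 d'.1 k d.2.2.1 d.2.2.2 d'.2.2.1 d'.2.2.2 := by
    rintro k ⟨S₀, Y₀, t₀, B⟩ ⟨hY₀, ht₀, ht₀S, hB1, hB2, hI⟩
    obtain ⟨S, Y, t₁, B', hY, hP, hfacts⟩ := hstepE Pstar S₀ Y₀ k B t₀ hY₀ ht₀ ht₀S hB1 hB2 hI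
    obtain ⟨hβB, -⟩ := hcert k Pstar S t₀ B t₁ B' Y hY hfacts ht₀ hP
    have hβk := hpin k
    obtain ⟨hr1, hr2'⟩ := hrange B (by linarith [hβB.2, hβk.1]) (hβB.1.trans hβk.2)
    obtain ⟨ht01, ht1S, -, hI', hg₁, hg₂, -, -⟩ := (hPkg A Y S k t₀ B t₁ B').1 hP
    exact ⟨⟨S, Y, t₁, B'⟩, ⟨hY, by linarith, ht1S, hr1.trans hg₁, hg₂.trans hr2', by push_cast; exact hI'⟩, hP⟩
  obtain ⟨S₀, Y₀, hS₀, hc0, hl0, hd0, hch0⟩ := (stub_wellposed hε₀ hε₁ 𝒟 αT 0 0).1 A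
  have hY₀ : Sol A S₀ Y₀ :=
    (hSol _ _ _).2 ⟨hS₀, hc0, hl0, hd0, fun i n t ht => by simp only [hkern]; exact hch0 i n t ht⟩
  have hP0 : 0 < Pstar := by linarith [hPrange.1]
  have hInv0 : Invo A Y₀ 0 Pstar 0 :=
    stub_invAtZero hε₀ hε₀' 𝒟 r Dc εb αT kern bvo wvo M0o M1o q R lad Sol hr hr2 h𝒟 hDc hεb hαT hkern hbvo
      hwvo hM0o hM1o hq hR hlad hSol F bhi Invo hInvo A S₀ Pstar Y₀ hY₀ rfl hP0 hF0
  obtain ⟨f, hf0, hf⟩ := threshold_recursion (fun (k : ℕ) (d : ℝ × (Fin 2 → ℤ → ℝ → ℝ) × ℝ × ℝ) => Sol A d.1 d.2.1 ∧ 0 ≤ d.2.2.1 ∧ d.2.2.1 < d.1 ∧ blo ≤ d.2.2.2 ∧ d.2.2.2 ≤ bhi ∧ Invo A d.2.1 k d.2.2.2 d.2.2.1)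
    (fun k d d' => Pkg A d'.2.1 d'.1 k d.2.2.1 d.2.2.2 d'.2.2.1 d'.2.2.2) ⟨S₀, Y₀, 0, Pstar⟩
    ⟨hY₀, le_rfl, hS₀, by linarith [hPrange.1], hPrange.2.trans hhibhi, by exact_mod_cast hInv0⟩ hrec
  set Ss : ℕ → ℝ := fun k => (f k).1 with hSs
  set Ys : ℕ → Fin 2 → ℤ → ℝ → ℝ := fun k => (f k).2.1 with hYs
  set ts : ℕ → ℝ := fun k => (f k).2.2.1 with hts
  set Bs : ℕ → ℝ := fun k => (f k).2.2.2 with hBs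
  have hgoodk : ∀ k : ℕ, Sol A (Ss k) (Ys k) ∧ 0 ≤ ts k ∧ ts k < Ss k ∧ blo ≤ Bs k ∧ Bs k ≤ bhi ∧ Invo A (Ys k) k (Bs k) (ts k) := fun k => (hf k).1
  have hlink : ∀ k : ℕ, Pkg A (Ys (k + 1)) (Ss (k + 1)) k (ts k) (Bs k) (ts (k + 1)) (Bs (k + 1)) := fun k => (hf k).2
  have hts0 : ts 0 = 0 := by simp only [hts, hf0]
  have hlink' : ∀ k : ℕ, ts k < ts (k + 1) ∧ ts (k + 1) < Ss (k + 1) ∧ ts (k + 1) ≤ ts k + 4 / R k ∧ (∀ t ∈ Icc (ts k) (ts (k + 1)), Tubeo A (Ys (k + 1)) k t) := fun k => by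
    obtain ⟨h1, h2, h3, -, -, -, htube, -⟩ := (hPkg A (Ys (k + 1)) (Ss (k + 1)) k (ts k) (Bs k) (ts (k + 1)) (Bs (k + 1))).1 (hlink k)
    exact ⟨h1, h2, h3, fun t ht => (htube t ht).1⟩
  have hts_nonneg : ∀ k, 0 ≤ ts k := fun k => (hgoodk k).2.1
  have hDc0 : 0 < Dc := by rw [hDc]; positivity
  have hstepP : ∀ k : ℕ, ts k < ts (k + 1) ∧ ts (k + 1) ≤ ts k + 4 / (Dc * (1 + ε₀) ^ (2 * k)) := fun k => by
    have hRk : R k = Dc * (1 + ε₀) ^ (2 * k) := by rw [hR]; norm_cast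
    exact ⟨(hlink' k).1, hRk ▸ (hlink' k).2.2.1⟩
  obtain ⟨hCd0, htsmono, hts_lt, hexK, hpace⟩ := threshold_pace hDc0 hε₀ hstepP
  set Cd : ℝ := 4 / Dc / (1 - ((1 + ε₀) ^ 2)⁻¹) with hCd
  set 𝒯 : Set ℝ := Set.range fun k : ℕ => ts (k + 1) with h𝒯
  set Sstar : ℝ := sSup 𝒯 with hSstar
  have hne : 𝒯.Nonempty := ⟨_, 0, rfl⟩
  have hSpos : 0 < Sstar := by have := hts_lt 0; rwa [hts0] at this
  have hsolT : ∀ T ∈ 𝒯, ∃ Y' : Fin 2 → ℤ → ℝ → ℝ, (∀ i n, ContinuousOn (Y' i n) (Ico 0 T)) ∧ (∀ i n t, n < 0 → Y' i n t = 0) ∧ (∀ S' : ℝ, S' < T → ∃ C : ℝ, ∀ (i : Fin 2) (n : ℤ), ∀ t ∈ Icc 0 S', (1 + ε₀) ^ ((20 : ℝ) * n) * |Y' i n t| ≤ C) ∧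
      (∀ (i : Fin 2) (n : ℤ), ∀ t ∈ Ico 0 T, Y' i n t = (if i = 0 ∧ n = 0 then A else 0) * kern i n t +
        ∫ s in (0 : ℝ)..t, kern i n (t - s) * quadTerm ε₀ αT Y' i n s) := by
    rintro _ ⟨k, rfl⟩
    obtain ⟨-, hc, hl, hd, hch⟩ := (hSol A (Ss (k + 1)) (Ys (k + 1))).1 (hgoodk (k + 1)).1
    have hT : ts (k + 1) < Ss (k + 1) := (hgoodk (k + 1)).2.2.1
    exact ⟨Ys (k + 1), fun i n => (hc i n).mono (Ico_subset_Ico_right hT.le), hl, fun S' hS' => hd S' (hS'.trans hT),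
      fun i n t ht => hch i n t ⟨ht.1, ht.2.trans hT⟩⟩
  obtain ⟨Yg, hgc, hgl, hgd, hgch⟩ := chain_glue hε₀ αT kern hka hkc 0 0 A hne hsolT
  have hYg : Sol A Sstar Yg := (hSol _ _ _).2 ⟨hSpos, hgc, hgl, hgd, hgch⟩
  have hagree : ∀ (k : ℕ) (i : Fin 2) (n : ℤ), ∀ t ∈ Icc 0 (ts k), Yg i n t = Ys k i n t := fun k i n t ht =>
    huniq A Sstar (Ss k) Yg (Ys k) hYg (hgoodk k).1 i n t ⟨ht.1, lt_min (ht.2.trans_lt (hts_lt k)) (ht.2.trans_lt (hgoodk k).2.2.1)⟩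
  have hεb1 : εb ≤ 1 := hεb6.trans (by norm_num)
  have htubeI : ∀ k : ℕ, ∀ t ∈ Icc (ts k) (ts (k + 1)), (∀ i : ℤ, i ≤ k + 1 → |bvo Yg i t| ≤ 2 * (bhi + 3) ∧ |wvo Yg i t| ≤ 2 * (bhi + 3)) ∧ (∀ j : ℕ, 2 ≤ j → |bvo Yg (k + j) t| ≤ εb * ((1 + ε₀) ^ (19 * (j - 2)))⁻¹ ∧
        |wvo Yg (k + j) t| ≤ εb * ((1 + ε₀) ^ (19 * (j - 2)))⁻¹) := by
    intro k t ht
    obtain ⟨hlow, hup⟩ := (hTubeo A (Ys (k + 1)) k t).1 ((hlink' k).2.2.2 t ht)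
    have ht' : t ∈ Icc 0 (ts (k + 1)) := ⟨(hts_nonneg k).trans ht.1, ht.2⟩
    have hb : ∀ m : ℤ, bvo Yg m t = bvo (Ys (k + 1)) m t := fun m => by rw [hbvo, hbvo, hagree (k + 1) 0 m t ht']
    have hw : ∀ m : ℤ, wvo Yg m t = wvo (Ys (k + 1)) m t := fun m => by rw [hwvo, hwvo, hagree (k + 1) 1 m t ht']
    refine ⟨fun i hi => ?_, fun j hj => ?_⟩
    · obtain ⟨h1, h2, -, -⟩ := hlow i hi; exact ⟨(hb i).symm ▸ h1, (hw i).symm ▸ h2⟩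
    · obtain ⟨h1, h2, -, -⟩ := hup j hj; rw [hb, hw, ← hlad]; exact ⟨h1, h2⟩
  obtain ⟨Mb, hMb⟩ := stub_typeIOfTube hε₀ hε₀' Dc εb (2 * (bhi + 3)) Cd Sstar A Yg αT (bvo Yg) (wvo Yg) ts hαT
    hDc0 hεb hεb1 (by linarith) hCd0 hSpos (fun n t => hbvo Yg n t) (fun n t => hwvo Yg n t) hgl hts0 htsmono hts_lt hexK
    hpace htubeI hgc
  have hnoext : ¬ ∃ (S' : ℝ) (Y' : Fin 2 → ℤ → ℝ → ℝ), Sstar < S' ∧ (∀ i n, ContinuousOn (Y' i n) (Ico 0 S')) ∧ (∀ i n t, n < 0 → Y' i n t = 0) ∧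
      (∀ S'' : ℝ, S'' < S' → ∃ C : ℝ, ∀ (i : Fin 2) (n : ℤ), ∀ t ∈ Icc 0 S'', (1 + ε₀) ^ ((20 : ℝ) * n) * |Y' i n t| ≤ C) ∧
      (∀ (i : Fin 2) (n : ℤ), ∀ t ∈ Ico 0 S',
        Y' i n t = (if i = 0 ∧ n = 0 then A else 0) * (pairing (heat t (cascadeWavelet ε₀ (𝒟.ψ i) n)) (cascadeWavelet ε₀ (𝒟.ψ i) n)).re +
          ∫ s in (0 : ℝ)..t,
            (pairing (heat (t - s) (cascadeWavelet ε₀ (𝒟.ψ i) n)) (cascadeWavelet ε₀ (𝒟.ψ i) n)).re *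
              quadTerm ε₀ αT Y' i n s) := by
    rintro ⟨S', Y', hSS', hc', hl', hd', hch'⟩
    have hY' : Sol A S' Y' :=
      (hSol _ _ _).2 ⟨hSpos.trans hSS', hc', hl', hd', fun i n t ht => by simp only [hkern]; exact hch' i n t ht⟩
    obtain ⟨C, hC⟩ := hd' Sstar hSS'
    have hblo0 : 0 < blo := by linarith
    refine threshold_growth_contra (Bs := Bs) (y := fun k => Y' 0 k (ts k)) hε₀ hblo0 (fun k => (hgoodk k).2.2.2.1)
      (fun k => ?_) (fun k => hC 0 k (ts k) ⟨hts_nonneg k, (hts_lt k).le⟩)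
    obtain ⟨hbk, -⟩ := (hInvo A (Ys k) k (Bs k) (ts k)).1 (hgoodk k).2.2.2.2.2
    have heq : Y' 0 k (ts k) = Ys k 0 k (ts k) :=
      huniq A S' (Ss k) Y' (Ys k) hY' (hgoodk k).1 0 k (ts k) ⟨hts_nonneg k, lt_min ((hts_lt k).trans hSS') (hgoodk k).2.2.1⟩
    rw [hbvo] at hbk
    have hP : 0 < (1 + ε₀) ^ (((k : ℤ) : ℝ) / 2) := Real.rpow_pos_of_pos hL _
    have : |Ys k 0 (k : ℤ) (ts k)| * (1 + ε₀) ^ (((k : ℤ) : ℝ) / 2) = |-((1 + ε₀) ^ (((k : ℤ) : ℝ) / 2) * Ys k 0 k (ts k))| := by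
      rw [abs_neg, abs_mul, abs_of_pos hP]; ring
    simp only [heq]
    rw [this, hbk]
    exact abs_of_pos (by linarith [(hgoodk k).2.2.2.1])
  refine ⟨A, Sstar, hSpos, ⟨Yg, hgc, hgl, hgd, fun i n t ht => ?_, Mb, fun t ht => hMb t ht⟩, hnoext⟩
  have := hgch i n t ht
  simp only [hkern] at this
  exact this

/-- **Registered marker stub of this file** (`stub_thresholdMarker`). [folklore] -/
theorem stub_thresholdMarker : ∀ x : ℝ, 0 ≤ x → 1 + 39 * x ≤ (1 + x) ^ 39 := fun x h => by simpa using one_add_mul_le_pow (show (-2:ℝ) ≤ x by linarith) 39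
end Summit.NavierStokesRegularity.NavierStokesRegularity.Theorems.PerpetualPumpAveragedTypeIBlowup
end
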